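/-
Copyright (c) 2026 the pub-hodgecm-mathlib formalisation cell (harness21).  Prover seat hodgecm-mathlib-LH4-p17 (g3) (Track A «FOUR-FRAME» free hand routed to L1 by the
CHAIR VALVE; LEAD F0P6-plan (g15) BATCH #225 «THEN (D-arch-Fub) `hAinf`»; block-D desk K2Liu-p12; K1-a♮ line lead K2E5-p16 (g8); second reader F0P2-p11 (g3);
consumers ★ p863921 `K2LiuIncoherentRankOneArchSplitOfFaces.hsplit_faces_of_archLetters` ∕ (D-arch-loc) `K2LiuIncoherentRankOneArchPlaceLettersOfScalarType`),
Track B «K2-LIT», #184♮ = hLiu418 = `stmt-HodgeConjecture-24832`.  THEOREMS ONLY (no `def`, no instance, no notation, no named-fact hypothesis, no `sorry`, default heartbeats).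
-/
import Summits.HodgeConjecture.HodgeConjecture.Theorems.K2LiuIncoherentRankOneArchSplitOfFaces   -- ★ p863921 (this seat): the frame vocabulary of the `hAinf` slot
import Mathlib.MeasureTheory.Integral.Pi                                                         -- `integral_fintype_prod_volume_eq_prod` (Fubini over a finite product)
import HarnessLib

/-!
# Crux `HLiu418`, #42S organ S5, BLOCK D row D-1 — (D-arch-Fub) THE PLACE-TENSOR LETTER `hAinf`: the raw archimedean block of a pure-tensor face is the Haar constant times
# the product over the complex places of the LOCAL blocks (`A X i s h = c_{X,h} · ∏_w Aloc X i w s h`) — Haar transport through the tube frame + Fubini over `∏_w ℝ^{2×2}`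

Cell `hodgecm-mathlib`, crux item hLiu418 = `stmt-HodgeConjecture-24832`, route `HCCMUnconditional`; squad K2 ∕ K2Liu (L1, LEAD F0P6-plan (g15)).  Lane
`--supports stmt-HodgeConjecture-24832 --as helper` (count-neutral).  CLOSES NO SOCKET.

THE SLOT (★ p863921 `hsplit_faces_of_archLetters` ∕ (D-arch-loc) `hsplit_faces_of_archLocalLetters`, binders `cA hAinf`; F0P2-p11 (g3) CENSUS #211 «(D-arch-Fub)»):
  `cA : Skew → H(𝔸) → φ → ℂ`,  `hAinf : ∀ X, ↑X ≠ 0 → det ↑X = 0 → ∀ h, ∀ i ∈ I X h, ∀ s, 1 < s.re → A X i s h = cA X h i * ∏ w ∈ Tinf, Aloc X i w s h`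
— on the convergence half-plane the RAW archimedean block of the face `i` (★ p863805 (b): ONE integral over `N_Δ(L⁺ ⊗ ℝ)` against the archimedean measure `νinf (T X h)` of the
integrand «conj ψ_{σ♭E_bb}(u_∞) · Finf i s ((w_Δ)_∞ · u · (gc X · h)_∞)») IS a scalar times the product over the complex places of the raw LOCAL blocks.
THE MATHEMATICS.  Two facts, both of record in the tree, and one presentation letter:
(T) HAAR TRANSPORT THROUGH THE TUBE FRAME — ★ `K2LiuArchUnipotentFrameCoordinates.exists_integral_frame_eq_smul` (K2Liu-p11, over ★ `exists_frameCoordinates`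
`Φ : N_Δ(L⁺⊗ℝ) ≃ₜ ({w ∣ complex} → ℝ^{n×n})`, `Φ(uv) = Φu + Φv`, `Fr u w = n(hermOfReal (Φ u w))`): for every left-invariant measure `ν` finite on compacts there is ONE `c : ℝ≥0` with
`∫ Ψ(Fr u) dν(u) = c • ∫_{∏_w ℝ^{n×n}} Ψ((n(hermOfReal r_w))_w) dr` for EVERY `Ψ` — the scalar `cA` IS this Haar constant (of `νinf (T X h)`, so it depends on `(X, h)`);
(F) FUBINI over the finite product `∏_w ℝ^{2×2}` with Lebesgue measure — Mathlib `integral_fintype_prod_volume_eq_prod`: `∫ ∏_w G_w(r_w) dr = ∏_w ∫ G_w` (no integrability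
hypothesis: both sides vanish together);
(P) THE PURE-TENSOR PRESENTATION of the integrand through the frame — `F X i s h u = ∏_w Ψloc X i w s h (Fr u w)` (the (o1) face is a pure tensor over the places and the Siegel character
of `N_Δ(𝔸)` at the archimedean component factors over the complex places through the frame coordinates; BY VALUE here, the (o1)∕(Φ-S1) presentation's letter).
Then `A X i s h = ∫ F dν = c • ∫ ∏_w Ψloc(n r_w) dr = c · ∏_w ∫ Ψloc X i w s h (n ρ) dρ = c · ∏_w Aloc X i w s h` once the local blocks are read as those local integrals (`hAloc`), and
the product over `{w ∣ complex}` is the product over `Tinf = univ` of `InfinitePlace L` (CM fields are totally complex; `hall`).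
THIS FILE, hypothesis-first ((T) as the letter `htrans` with its constant `c X h`, payer ★ `exists_integral_frame_eq_smul` BY NAME at `νinf (T X h)`; (P) as `hpure`; the raw block
as an integral `hAint`, payer ★ p863805 (b); the local blocks as local integrals `hAloc`; measure space, frame target and local coordinate types GENERIC):
* §1 **`integral_eq_smul_prod_of_frameTensor`** ∕ **`integral_eq_mul_prod_of_frameTensor`** — generic: transport letter + pure tensor ⟹ `∫ F dν = c · ∏_w ∫ Ψloc w (n ρ) dρ`;
  `prod_subtype_eq_prod_finset_of_forall` — `∏_{w : {w ∣ p w}} f w = ∏_{w ∈ T} f ⟨w, _⟩` when `p` holds everywhere and `T ∋` every `w`.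
* §2 AT THE K2_Liu FRAME: **`hAinf_of_frameTensor`** — the `hAinf` binder of ★ p863921 VERBATIM (generic `Aloc`) at `cA := fun X h _ => ↑(c X h)`, from `hall hAint htrans hpure hAloc`;
  **`hAinf_comp_of_frameTensor`** — the same in (D-arch-loc)'s letters (`Aloc X i w s h := Araw X i w s (comp X h w)`); **`exists_cA_hAinf_of_frameTensor`** — ∃-form over
  `htransE : ∀ X h, ∃ c, ∀ Ψ, …` (★'s conclusion shape per measure; `choose`).
HONEST LABEL.  Count-neutral helper (Fubini bookkeeping); the transport constant, the pure-tensor presentation and the integral readings enter BY VALUE with named payers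
(★ `exists_integral_frame_eq_smul`; the (o1)∕(Φ-S1) arch presentation; ★ p863805 (b)); `HC_CM` is proved only modulo the 7 printed citations (2 remaining named inputs:
hLiu418 = `stmt-HodgeConjecture-24832`, h413 = `stmt-HodgeConjecture-24833`) until rung 0 closes.

## References
* [KudlaRallis1994] S. Kudla, S. Rallis, *A regularized Siegel–Weil formula: the first term identity*, Ann. of Math. 140 (1994): §2 (2.10)–(2.12) (Euler factorisation of
  Whittaker coefficients of factorizable sections — the archimedean places included).
* [Tate1967] J. Tate, *Fourier analysis in number fields and Hecke's zeta-functions* (Cassels–Fröhlich 1967): §3 Thm. 3.3.1 (integrals of factorizable functions factor).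
* [Folland1995] G. B. Folland, *A Course in Abstract Harmonic Analysis* (1995): §2.2 (uniqueness of Haar measure up to a constant — the transport constant `c`).
* [BorelJacquet1979] A. Borel, H. Jacquet, *Automorphic forms and automorphic representations*, PSPM 33.1 (1979): §4.1 (archimedean component `∏_w` of an adelic group).
-/

set_option autoImplicit false
set_option linter.dupNamespace false -- the mandated namespace repeats `HodgeConjecture.HodgeConjecture`

noncomputable section

open scoped Matrix NNReal
open MeasureTheory NumberField NumberField.InfinitePlace IsDedekindDomain
open Literature.NumberTheory.Automorphic Literature.NumberTheory.Automorphic.UnitaryGroup Literature.NumberTheory.GaloisRepresentations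
open Literature.NumberTheory.GelbartRogawski1991 Literature.NumberTheory.GelbartRogawski1991.GRConstruction

namespace Summit.HodgeConjecture.HodgeConjecture.Cruxes.HLiu418.K2LiuIncoherentRankOneArchPlaceTensor

open K2LiuSiegelUnipotentFourierDefs

/-! ## §1 Generic: transport through a frame + Fubini over a finite product of coordinate spaces -/

/-- **TRANSPORT + FUBINI (`•`-form).**  A measure `ν` on `Ω`, a frame map `Fr : Ω → σ → M` (finitely many «places» `σ`), local coordinates `nfr w : R → M` on a measure space `R`
(σ-finite), and the TRANSPORT letter `∫ Ψ(Fr u) dν = c • ∫_{σ → R} Ψ((nfr w (r w))_w) dr` for every `Ψ` (★ `exists_integral_frame_eq_smul`'s shape); an integrand that is a PURE TENSOR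
through the frame, `F u = ∏_w Ψloc w (Fr u w)` ⟹ `∫ F dν = c • ∏_w ∫ Ψloc w (nfr w ρ) dρ` (Mathlib `integral_fintype_prod_volume_eq_prod`, hypothesis-free).
[cite: Tate1967, §3 Thm. 3.3.1] [cite: Folland1995, §2.2] -/
theorem integral_eq_smul_prod_of_frameTensor {Ω σ M R : Type*} [MeasurableSpace Ω] (ν : Measure Ω) [Fintype σ]
    [MeasureSpace R] [SigmaFinite (volume : Measure R)]
    (Fr : Ω → σ → M) (nfr : σ → R → M) (c : ℝ≥0)
    (htrans : ∀ Ψ : (σ → M) → ℂ, ∫ u, Ψ (Fr u) ∂ν = c • ∫ r : σ → R, Ψ (fun w => nfr w (r w)))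
    {F : Ω → ℂ} (Ψloc : σ → M → ℂ) (hpure : ∀ u, F u = ∏ w, Ψloc w (Fr u w)) :
    ∫ u, F u ∂ν = c • ∏ w, ∫ ρ : R, Ψloc w (nfr w ρ) := by
  have hF : F = fun u => (fun m : σ → M => ∏ w, Ψloc w (m w)) (Fr u) := funext hpure
  have hfub : ∫ r : σ → R, ∏ w, Ψloc w (nfr w (r w)) = ∏ w, ∫ ρ : R, Ψloc w (nfr w ρ) :=
    integral_fintype_prod_volume_eq_prod (fun w ρ => Ψloc w (nfr w ρ))
  rw [hF, htrans, ← hfub]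

/-- **TRANSPORT + FUBINI (`·`-form)**: the same with the constant as a complex scalar, `∫ F dν = ↑c · ∏_w ∫ Ψloc w (nfr w ρ) dρ`. [cite: Tate1967, §3 Thm. 3.3.1] [cite: Folland1995, §2.2] -/
theorem integral_eq_mul_prod_of_frameTensor {Ω σ M R : Type*} [MeasurableSpace Ω] (ν : Measure Ω) [Fintype σ]
    [MeasureSpace R] [SigmaFinite (volume : Measure R)]
    (Fr : Ω → σ → M) (nfr : σ → R → M) (c : ℝ≥0)
    (htrans : ∀ Ψ : (σ → M) → ℂ, ∫ u, Ψ (Fr u) ∂ν = c • ∫ r : σ → R, Ψ (fun w => nfr w (r w)))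
    {F : Ω → ℂ} (Ψloc : σ → M → ℂ) (hpure : ∀ u, F u = ∏ w, Ψloc w (Fr u w)) :
    ∫ u, F u ∂ν = ((c : ℝ) : ℂ) * ∏ w, ∫ ρ : R, Ψloc w (nfr w ρ) := by
  rw [integral_eq_smul_prod_of_frameTensor ν Fr nfr c htrans Ψloc hpure, NNReal.smul_def, Complex.real_smul]

/-- **REINDEXING A PRODUCT OVER AN EVERYWHERE-TRUE SUBTYPE TO A FINSET CONTAINING EVERYTHING**: if `p w` holds for every `w` (e.g. every infinite place of a CM field is complex) and
`T ∋ w` for every `w` (★'s `hall`), then `∏_{w : {w ∣ p w}} f w = ∏_{w ∈ T} f ⟨w, hp w⟩`. [cite: BorelJacquet1979, §4.1] -/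
theorem prod_subtype_eq_prod_finset_of_forall {α : Type*} [Fintype α] {p : α → Prop} [Fintype {w : α // p w}] (hp : ∀ w, p w)
    (T : Finset α) (hall : ∀ w, w ∈ T) (f : {w : α // p w} → ℂ) :
    ∏ w : {w : α // p w}, f w = ∏ w ∈ T, f ⟨w, hp w⟩ := by
  rw [Fintype.prod_equiv (Equiv.subtypeUnivEquiv hp) f (fun w => f ⟨w, hp w⟩) (fun w => rfl),
    ← Finset.prod_subset (Finset.subset_univ T) (fun w _ hw => absurd (hall w) hw)]

/-! ## §2 At the K2_Liu frame: the `hAinf` letter of ★ p863921 ∕ (D-arch-loc) -/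

section Frame

variable (L : Type) [Field L] [NumberField L] [IsCMField L]

variable {N M n : ℕ} (e : Fin N × Fin M ≃ Fin n)
  (dV : Fin N → L) (hdV : ∀ i, IsCMField.complexConj L (dV i) = dV i)
  (dW : Fin M → L) (hdW : ∀ i, IsCMField.complexConj L (dW i) = dW i)

/-- **`hAinf` FROM THE FRAME TENSOR (the head; (D-arch-Fub)).**  Faces `I X h`, places `Tinf` with ★'s `hall`; the raw archimedean block `A` (★ p863404's binder) READ as an integral
`A X i s h = ∫ F X i s h u dν_{X,h}(u)` over a measure space `Ω` (of record `N_Δ(L⁺⊗ℝ)`, `ν_{X,h} = νinf (T X h)`; ★ p863805 (b)) — `hAint`; the TRANSPORT letter through a frame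
`Fr : Ω → {w ∣ complex} → M` with local coordinates `nfr w : R → M` and constant `c X h` (★ `exists_integral_frame_eq_smul` at `ν_{X,h}`) — `htrans`; the PURE-TENSOR presentation of the
integrand through the frame — `hpure`; and the local blocks READ as the local integrals, `Aloc X i w s h = ∫ Ψloc X i ⟨w, _⟩ s h (nfr _ ρ) dρ` — `hAloc` ⟹ ★ p863921's `hAinf` binder VERBATIM at
`cA := fun X h _ => ((c X h : ℝ) : ℂ)`: `∀ X, ↑X ≠ 0 → det ↑X = 0 → ∀ h, ∀ i ∈ I X h, ∀ s, 1 < s.re → A X i s h = ↑(c X h) * ∏ w ∈ Tinf, Aloc X i w s h`.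
[cite: KudlaRallis1994, §2 (2.10)–(2.12)] [cite: Tate1967, §3 Thm. 3.3.1] [cite: Folland1995, §2.2] [cite: BorelJacquet1979, §4.1] -/
theorem hAinf_of_frameTensor {φ : Type*} [Fintype {w : InfinitePlace L // w.IsComplex}]
    (I : skewMatrices ((IsCMField.complexConj L : L ≃ₐ[Fp L] L) : L →+* L) ((gramR L e dV hdV dW hdW).map (algebraMap (Fp L) L)) → HA L e dV hdV dW hdW → Finset φ)
    (Tinf : Finset (InfinitePlace L)) (hall : ∀ w : InfinitePlace L, w ∈ Tinf)
    (A : skewMatrices ((IsCMField.complexConj L : L ≃ₐ[Fp L] L) : L →+* L) ((gramR L e dV hdV dW hdW).map (algebraMap (Fp L) L)) → φ → ℂ → HA L e dV hdV dW hdW → ℂ)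
    -- the raw block as an integral over the archimedean unipotent measure space
    {Ω : Type*} [MeasurableSpace Ω]
    (ν : skewMatrices ((IsCMField.complexConj L : L ≃ₐ[Fp L] L) : L →+* L) ((gramR L e dV hdV dW hdW).map (algebraMap (Fp L) L)) → HA L e dV hdV dW hdW → Measure Ω)
    (F : skewMatrices ((IsCMField.complexConj L : L ≃ₐ[Fp L] L) : L →+* L) ((gramR L e dV hdV dW hdW).map (algebraMap (Fp L) L)) → φ → ℂ → HA L e dV hdV dW hdW → Ω → ℂ)
    (hAint : ∀ X : skewMatrices ((IsCMField.complexConj L : L ≃ₐ[Fp L] L) : L →+* L) ((gramR L e dV hdV dW hdW).map (algebraMap (Fp L) L)),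
      (X : Matrix (Fin n) (Fin n) L) ≠ 0 → (X : Matrix (Fin n) (Fin n) L).det = 0 → ∀ (h : HA L e dV hdV dW hdW), ∀ i ∈ I X h, ∀ s : ℂ, 1 < s.re →
        A X i s h = ∫ u, F X i s h u ∂(ν X h))
    -- the transport through the frame, with its constant (★ `exists_integral_frame_eq_smul`'s shape at `ν X h`)
    {Mfr R : Type*} [MeasureSpace R] [SigmaFinite (volume : Measure R)]
    (Fr : Ω → {w : InfinitePlace L // w.IsComplex} → Mfr) (nfr : {w : InfinitePlace L // w.IsComplex} → R → Mfr)
    (c : skewMatrices ((IsCMField.complexConj L : L ≃ₐ[Fp L] L) : L →+* L) ((gramR L e dV hdV dW hdW).map (algebraMap (Fp L) L)) → HA L e dV hdV dW hdW → ℝ≥0)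
    (htrans : ∀ (X : skewMatrices ((IsCMField.complexConj L : L ≃ₐ[Fp L] L) : L →+* L) ((gramR L e dV hdV dW hdW).map (algebraMap (Fp L) L))) (h : HA L e dV hdV dW hdW)
      (Ψ : ({w : InfinitePlace L // w.IsComplex} → Mfr) → ℂ),
      ∫ u, Ψ (Fr u) ∂(ν X h) = c X h • ∫ r : {w : InfinitePlace L // w.IsComplex} → R, Ψ (fun w => nfr w (r w)))
    -- the pure-tensor presentation of the integrand through the frame
    (Ψloc : skewMatrices ((IsCMField.complexConj L : L ≃ₐ[Fp L] L) : L →+* L) ((gramR L e dV hdV dW hdW).map (algebraMap (Fp L) L)) → φ →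
      {w : InfinitePlace L // w.IsComplex} → ℂ → HA L e dV hdV dW hdW → Mfr → ℂ)
    (hpure : ∀ X : skewMatrices ((IsCMField.complexConj L : L ≃ₐ[Fp L] L) : L →+* L) ((gramR L e dV hdV dW hdW).map (algebraMap (Fp L) L)),
      (X : Matrix (Fin n) (Fin n) L) ≠ 0 → (X : Matrix (Fin n) (Fin n) L).det = 0 → ∀ (h : HA L e dV hdV dW hdW), ∀ i ∈ I X h, ∀ (s : ℂ) (u : Ω),
        F X i s h u = ∏ w, Ψloc X i w s h (Fr u w))
    -- the local blocks read as the local integrals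
    (Aloc : skewMatrices ((IsCMField.complexConj L : L ≃ₐ[Fp L] L) : L →+* L) ((gramR L e dV hdV dW hdW).map (algebraMap (Fp L) L)) → φ → InfinitePlace L → ℂ →
      HA L e dV hdV dW hdW → ℂ)
    (hAloc : ∀ X : skewMatrices ((IsCMField.complexConj L : L ≃ₐ[Fp L] L) : L →+* L) ((gramR L e dV hdV dW hdW).map (algebraMap (Fp L) L)),
      (X : Matrix (Fin n) (Fin n) L) ≠ 0 → (X : Matrix (Fin n) (Fin n) L).det = 0 → ∀ (h : HA L e dV hdV dW hdW), ∀ i ∈ I X h, ∀ (w : InfinitePlace L) (s : ℂ), 1 < s.re →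
        Aloc X i w s h = ∫ ρ : R, Ψloc X i ⟨w, IsTotallyComplex.isComplex w⟩ s h (nfr ⟨w, IsTotallyComplex.isComplex w⟩ ρ)) :
    ∀ X : skewMatrices ((IsCMField.complexConj L : L ≃ₐ[Fp L] L) : L →+* L) ((gramR L e dV hdV dW hdW).map (algebraMap (Fp L) L)),
      (X : Matrix (Fin n) (Fin n) L) ≠ 0 → (X : Matrix (Fin n) (Fin n) L).det = 0 → ∀ (h : HA L e dV hdV dW hdW), ∀ i ∈ I X h,
        ∀ s : ℂ, 1 < s.re → A X i s h = (fun X h _ => ((c X h : ℝ) : ℂ)) X h i * ∏ w ∈ Tinf, Aloc X i w s h := by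
  intro X hX0 hdet h i hi s hs
  rw [hAint X hX0 hdet h i hi s hs,
    integral_eq_mul_prod_of_frameTensor (ν X h) Fr nfr (c X h) (htrans X h) (fun w m => Ψloc X i w s h m) (hpure X hX0 hdet h i hi s),
    prod_subtype_eq_prod_finset_of_forall IsTotallyComplex.isComplex Tinf hall]
  exact congrArg _ (Finset.prod_congr rfl fun w _ => (hAloc X hX0 hdet h i hi w s hs).symm)

/-- **`hAinf` IN (D-arch-loc)'s LETTERS**: the same with the local blocks at the component, `Aloc X i w s h := Araw X i w s (comp X h w)` (★ `K2LiuIncoherentRankOneArchPlaceLettersOfScalarType`'s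
compositions; `hAraw` reads them as the local integrals) — the `hAinf` binder of `hsplit_faces_of_archLocalLetters` VERBATIM at `cA := fun X h _ => ↑(c X h)`.
NB (second reader F0P2-p11 (g3)): `hAraw` is the ONE letter in which the producer of the pure-tensor presentation (P) SAYS that the local integrand `Ψloc X i ⟨w, _⟩ s h` depends on the
adelic point `h` only through its component `comp X h w` (true for the (o1) face: the translate `(gc X · h)_∞` enters the local integrand through its `w`-component) — so (P)'s payer
types `hpure` and `hAraw` together, once, for this file and for ★ `K2LiuIncoherentRankOneArchPlaceLettersOfScalarType`.
[cite: KudlaRallis1994, §2 (2.10)–(2.12)] [cite: Tate1967, §3 Thm. 3.3.1] -/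
theorem hAinf_comp_of_frameTensor {φ P : Type*} [Fintype {w : InfinitePlace L // w.IsComplex}]
    (I : skewMatrices ((IsCMField.complexConj L : L ≃ₐ[Fp L] L) : L →+* L) ((gramR L e dV hdV dW hdW).map (algebraMap (Fp L) L)) → HA L e dV hdV dW hdW → Finset φ)
    (Tinf : Finset (InfinitePlace L)) (hall : ∀ w : InfinitePlace L, w ∈ Tinf)
    (A : skewMatrices ((IsCMField.complexConj L : L ≃ₐ[Fp L] L) : L →+* L) ((gramR L e dV hdV dW hdW).map (algebraMap (Fp L) L)) → φ → ℂ → HA L e dV hdV dW hdW → ℂ)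
    {Ω : Type*} [MeasurableSpace Ω]
    (ν : skewMatrices ((IsCMField.complexConj L : L ≃ₐ[Fp L] L) : L →+* L) ((gramR L e dV hdV dW hdW).map (algebraMap (Fp L) L)) → HA L e dV hdV dW hdW → Measure Ω)
    (F : skewMatrices ((IsCMField.complexConj L : L ≃ₐ[Fp L] L) : L →+* L) ((gramR L e dV hdV dW hdW).map (algebraMap (Fp L) L)) → φ → ℂ → HA L e dV hdV dW hdW → Ω → ℂ)
    (hAint : ∀ X : skewMatrices ((IsCMField.complexConj L : L ≃ₐ[Fp L] L) : L →+* L) ((gramR L e dV hdV dW hdW).map (algebraMap (Fp L) L)),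
      (X : Matrix (Fin n) (Fin n) L) ≠ 0 → (X : Matrix (Fin n) (Fin n) L).det = 0 → ∀ (h : HA L e dV hdV dW hdW), ∀ i ∈ I X h, ∀ s : ℂ, 1 < s.re →
        A X i s h = ∫ u, F X i s h u ∂(ν X h))
    {Mfr R : Type*} [MeasureSpace R] [SigmaFinite (volume : Measure R)]
    (Fr : Ω → {w : InfinitePlace L // w.IsComplex} → Mfr) (nfr : {w : InfinitePlace L // w.IsComplex} → R → Mfr)
    (c : skewMatrices ((IsCMField.complexConj L : L ≃ₐ[Fp L] L) : L →+* L) ((gramR L e dV hdV dW hdW).map (algebraMap (Fp L) L)) → HA L e dV hdV dW hdW → ℝ≥0)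
    (htrans : ∀ (X : skewMatrices ((IsCMField.complexConj L : L ≃ₐ[Fp L] L) : L →+* L) ((gramR L e dV hdV dW hdW).map (algebraMap (Fp L) L))) (h : HA L e dV hdV dW hdW)
      (Ψ : ({w : InfinitePlace L // w.IsComplex} → Mfr) → ℂ),
      ∫ u, Ψ (Fr u) ∂(ν X h) = c X h • ∫ r : {w : InfinitePlace L // w.IsComplex} → R, Ψ (fun w => nfr w (r w)))
    (Ψloc : skewMatrices ((IsCMField.complexConj L : L ≃ₐ[Fp L] L) : L →+* L) ((gramR L e dV hdV dW hdW).map (algebraMap (Fp L) L)) → φ →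
      {w : InfinitePlace L // w.IsComplex} → ℂ → HA L e dV hdV dW hdW → Mfr → ℂ)
    (hpure : ∀ X : skewMatrices ((IsCMField.complexConj L : L ≃ₐ[Fp L] L) : L →+* L) ((gramR L e dV hdV dW hdW).map (algebraMap (Fp L) L)),
      (X : Matrix (Fin n) (Fin n) L) ≠ 0 → (X : Matrix (Fin n) (Fin n) L).det = 0 → ∀ (h : HA L e dV hdV dW hdW), ∀ i ∈ I X h, ∀ (s : ℂ) (u : Ω),
        F X i s h u = ∏ w, Ψloc X i w s h (Fr u w))
    -- (D-arch-loc)'s component map and raw local blocks, read as the local integrals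
    (comp : skewMatrices ((IsCMField.complexConj L : L ≃ₐ[Fp L] L) : L →+* L) ((gramR L e dV hdV dW hdW).map (algebraMap (Fp L) L)) → HA L e dV hdV dW hdW → InfinitePlace L → P)
    (Araw : skewMatrices ((IsCMField.complexConj L : L ≃ₐ[Fp L] L) : L →+* L) ((gramR L e dV hdV dW hdW).map (algebraMap (Fp L) L)) → φ → InfinitePlace L → ℂ → P → ℂ)
    (hAraw : ∀ X : skewMatrices ((IsCMField.complexConj L : L ≃ₐ[Fp L] L) : L →+* L) ((gramR L e dV hdV dW hdW).map (algebraMap (Fp L) L)),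
      (X : Matrix (Fin n) (Fin n) L) ≠ 0 → (X : Matrix (Fin n) (Fin n) L).det = 0 → ∀ (h : HA L e dV hdV dW hdW), ∀ i ∈ I X h, ∀ (w : InfinitePlace L) (s : ℂ), 1 < s.re →
        Araw X i w s (comp X h w) = ∫ ρ : R, Ψloc X i ⟨w, IsTotallyComplex.isComplex w⟩ s h (nfr ⟨w, IsTotallyComplex.isComplex w⟩ ρ)) :
    ∀ X : skewMatrices ((IsCMField.complexConj L : L ≃ₐ[Fp L] L) : L →+* L) ((gramR L e dV hdV dW hdW).map (algebraMap (Fp L) L)),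
      (X : Matrix (Fin n) (Fin n) L) ≠ 0 → (X : Matrix (Fin n) (Fin n) L).det = 0 → ∀ (h : HA L e dV hdV dW hdW), ∀ i ∈ I X h,
        ∀ s : ℂ, 1 < s.re → A X i s h = (fun X h _ => ((c X h : ℝ) : ℂ)) X h i * ∏ w ∈ Tinf, Araw X i w s (comp X h w) :=
  hAinf_of_frameTensor L e dV hdV dW hdW I Tinf hall A ν F hAint Fr nfr c htrans Ψloc hpure (fun X i w s h => Araw X i w s (comp X h w)) hAraw

/-- **∃-FORM**: with the transport letter in ★ `exists_integral_frame_eq_smul`'s own shape per measure (`htransE : ∀ X h, ∃ c, ∀ Ψ, …`), there EXISTS a scalar `cA` (the chosen Haar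
constants) with the `hAinf` letter of ★ p863921 (`choose`). [cite: Folland1995, §2.2] [cite: Tate1967, §3 Thm. 3.3.1] -/
theorem exists_cA_hAinf_of_frameTensor {φ : Type*} [Fintype {w : InfinitePlace L // w.IsComplex}]
    (I : skewMatrices ((IsCMField.complexConj L : L ≃ₐ[Fp L] L) : L →+* L) ((gramR L e dV hdV dW hdW).map (algebraMap (Fp L) L)) → HA L e dV hdV dW hdW → Finset φ)
    (Tinf : Finset (InfinitePlace L)) (hall : ∀ w : InfinitePlace L, w ∈ Tinf)
    (A : skewMatrices ((IsCMField.complexConj L : L ≃ₐ[Fp L] L) : L →+* L) ((gramR L e dV hdV dW hdW).map (algebraMap (Fp L) L)) → φ → ℂ → HA L e dV hdV dW hdW → ℂ)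
    {Ω : Type*} [MeasurableSpace Ω]
    (ν : skewMatrices ((IsCMField.complexConj L : L ≃ₐ[Fp L] L) : L →+* L) ((gramR L e dV hdV dW hdW).map (algebraMap (Fp L) L)) → HA L e dV hdV dW hdW → Measure Ω)
    (F : skewMatrices ((IsCMField.complexConj L : L ≃ₐ[Fp L] L) : L →+* L) ((gramR L e dV hdV dW hdW).map (algebraMap (Fp L) L)) → φ → ℂ → HA L e dV hdV dW hdW → Ω → ℂ)
    (hAint : ∀ X : skewMatrices ((IsCMField.complexConj L : L ≃ₐ[Fp L] L) : L →+* L) ((gramR L e dV hdV dW hdW).map (algebraMap (Fp L) L)),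
      (X : Matrix (Fin n) (Fin n) L) ≠ 0 → (X : Matrix (Fin n) (Fin n) L).det = 0 → ∀ (h : HA L e dV hdV dW hdW), ∀ i ∈ I X h, ∀ s : ℂ, 1 < s.re →
        A X i s h = ∫ u, F X i s h u ∂(ν X h))
    {Mfr R : Type*} [MeasureSpace R] [SigmaFinite (volume : Measure R)]
    (Fr : Ω → {w : InfinitePlace L // w.IsComplex} → Mfr) (nfr : {w : InfinitePlace L // w.IsComplex} → R → Mfr)
    (htransE : ∀ (X : skewMatrices ((IsCMField.complexConj L : L ≃ₐ[Fp L] L) : L →+* L) ((gramR L e dV hdV dW hdW).map (algebraMap (Fp L) L))) (h : HA L e dV hdV dW hdW),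
      ∃ c : ℝ≥0, ∀ Ψ : ({w : InfinitePlace L // w.IsComplex} → Mfr) → ℂ,
        ∫ u, Ψ (Fr u) ∂(ν X h) = c • ∫ r : {w : InfinitePlace L // w.IsComplex} → R, Ψ (fun w => nfr w (r w)))
    (Ψloc : skewMatrices ((IsCMField.complexConj L : L ≃ₐ[Fp L] L) : L →+* L) ((gramR L e dV hdV dW hdW).map (algebraMap (Fp L) L)) → φ →
      {w : InfinitePlace L // w.IsComplex} → ℂ → HA L e dV hdV dW hdW → Mfr → ℂ)
    (hpure : ∀ X : skewMatrices ((IsCMField.complexConj L : L ≃ₐ[Fp L] L) : L →+* L) ((gramR L e dV hdV dW hdW).map (algebraMap (Fp L) L)),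
      (X : Matrix (Fin n) (Fin n) L) ≠ 0 → (X : Matrix (Fin n) (Fin n) L).det = 0 → ∀ (h : HA L e dV hdV dW hdW), ∀ i ∈ I X h, ∀ (s : ℂ) (u : Ω),
        F X i s h u = ∏ w, Ψloc X i w s h (Fr u w))
    (Aloc : skewMatrices ((IsCMField.complexConj L : L ≃ₐ[Fp L] L) : L →+* L) ((gramR L e dV hdV dW hdW).map (algebraMap (Fp L) L)) → φ → InfinitePlace L → ℂ →
      HA L e dV hdV dW hdW → ℂ)
    (hAloc : ∀ X : skewMatrices ((IsCMField.complexConj L : L ≃ₐ[Fp L] L) : L →+* L) ((gramR L e dV hdV dW hdW).map (algebraMap (Fp L) L)),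
      (X : Matrix (Fin n) (Fin n) L) ≠ 0 → (X : Matrix (Fin n) (Fin n) L).det = 0 → ∀ (h : HA L e dV hdV dW hdW), ∀ i ∈ I X h, ∀ (w : InfinitePlace L) (s : ℂ), 1 < s.re →
        Aloc X i w s h = ∫ ρ : R, Ψloc X i ⟨w, IsTotallyComplex.isComplex w⟩ s h (nfr ⟨w, IsTotallyComplex.isComplex w⟩ ρ)) :
    ∃ cA : skewMatrices ((IsCMField.complexConj L : L ≃ₐ[Fp L] L) : L →+* L) ((gramR L e dV hdV dW hdW).map (algebraMap (Fp L) L)) → HA L e dV hdV dW hdW → φ → ℂ,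
      ∀ X : skewMatrices ((IsCMField.complexConj L : L ≃ₐ[Fp L] L) : L →+* L) ((gramR L e dV hdV dW hdW).map (algebraMap (Fp L) L)),
        (X : Matrix (Fin n) (Fin n) L) ≠ 0 → (X : Matrix (Fin n) (Fin n) L).det = 0 → ∀ (h : HA L e dV hdV dW hdW), ∀ i ∈ I X h,
          ∀ s : ℂ, 1 < s.re → A X i s h = cA X h i * ∏ w ∈ Tinf, Aloc X i w s h := by
  choose c hc using htransE
  exact ⟨fun X h _ => ((c X h : ℝ) : ℂ), hAinf_of_frameTensor L e dV hdV dW hdW I Tinf hall A ν F hAint Fr nfr c hc Ψloc hpure Aloc hAloc⟩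

end Frame

end Summit.HodgeConjecture.HodgeConjecture.Cruxes.HLiu418.K2LiuIncoherentRankOneArchPlaceTensor

end
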